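import Summits.CriticalPhenomena.PercolationContinuityZ3.Theses.PercBurnResprinkle
import Literature.Probability.Percolation.PercolationProofs
import Literature.Probability.Percolation.StaticRenormalizationBlocks
import Literature.Probability.Percolation.BondPercolationSymmetry
import Literature.Probability.LatticeModels.StarBoundary
import HarnessLib
import Literature.Probability.Percolation.PlanarDuality
import Literature.Probability.LatticeModels.LatticeWalkCrossing

/-!
# Crux `PercBurnResprinkle.VacantReignition` (stmt-CriticalPhenomena-7203), line `holes-are-fresh` — stub `stub_coarseGlue`

(worker of lead prover-line-stmt-CriticalPhenomena-7203-c1-0; registered stub of the skeleton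
`Cruxes/VacantReignition/Lines/holes_are_fresh.lean`, statement DEF-FREE over tree vocabulary; pure theorem
file, lands with `--supports stmt-CriticalPhenomena-7203`, anchored at the registered helper stub
`vacantReignition_cgs_core` (the abstract form, stated verbatim with all binders after the colon; the registry
entry of `stub_coarseGlue` itself is length-truncated).  Self-contained; the planar lemmas are also available
publicly in `…CoarseGlueAux.lean` (`vacantReignition_cg_*`).)

**COARSE GLUING** (Ahlberg–Duminil-Copin–Kozma–Sidoravicius, arXiv:1302.6872 §2, proof of Thm 1 p. 6,
step 2; deterministic).  Blocks of the layer `{x₀ = 0}` of `ℤ³` are indexed by `z ∈ ℤ²` via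
`ι z = (0, z₀, z₁)`; VG = VACANT ∧ GOOD.  A coarse site `x ∈ ℤ²` (spacing `S ≥ 1`) is OPEN if
`H(x) = [Sx₀-S, Sx₀+2S] × [Sx₁, Sx₁+S]` has a left-right and `V(x) = [Sx₀, Sx₀+S] × [Sx₁-S, Sx₁+2S]` a
bottom-top crossing by planar nearest-neighbour walks of VG blocks.  `stub_coarseGlue`: if `0` is open and
the `★`-cluster of open sites at `0` is infinite, some block `z ∈ H(0)` has an infinite cluster at `ι z` in
the block configuration `{E ∈ E(ℤ³) | both endpoints VG}`.  Proof (`vacantReignition_cgs_core`, abstract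
block predicate `G`, set `O` of open sites): (1) MEETING — transversal walks of a rectangle meet
(`exists_subwalk_slab` + the discrete Jordan-curve lemma `exists_mem_support_of_crossing`), so any
H-crossing of a site meets any V-crossing of it (`_hv`), and crossings of `★`-adjacent open sites meet in
a common `S × S` square (`_step`); (2) LIFT — a planar VG walk is under `ι` an open block path (`_lift`),
so the planar trace `T` of the block cluster of `ι a₀` (`a₀` = start of the H-crossing of `0`) is closed
under planar VG walks; (3) CHAINING — by induction on `ReflTransGen (starRel O) 0 x`, every VG crossing
of every cluster site lies in `T` (`_site`, `_step`); (4) COUNTING — the starts `a(x) ∈ T ∩ H(x)` have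
finite fibres in `x` (`_finite`) and `ι` is injective, so the block cluster of `ι a₀ ∈ ι(H(0))` is
infinite.  References: [AhlbergEtAl2015] §2; Kesten, *Percolation theory for mathematicians* (1982)
§2.2 [KestenPTM1982].  No measure theory, no new definitions.
-/

noncomputable section

namespace Summit.CriticalPhenomena.PercolationContinuityZ3.Theorems

open Literature.Probability.Percolation Literature.Probability.LatticeModels

/-- **Transversal walks of a rectangle meet**: `P` from left of column `L` to right of column `R` inside
the rows `[B, T]` and `Q` from below row `B` to above row `T` inside the columns `[L, R]` share a vertex
(`exists_subwalk_slab`, `exists_mem_support_of_crossing`; Kesten 1982 §2.2). [folklore] -/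
private theorem vacantReignition_cgs_meet {a b c d : Fin 2 → ℤ} (P : (zdGraph 2).Walk a b)
    (Q : (zdGraph 2).Walk c d) {L R B T : ℤ} (hLR : L ≤ R) (hBT : B ≤ T) (ha : a 0 ≤ L) (hb : R ≤ b 0)
    (hP : ∀ z ∈ P.support, B ≤ z 1 ∧ z 1 ≤ T) (hc : c 1 ≤ B) (hd : T ≤ d 1)
    (hQ : ∀ z ∈ Q.support, L ≤ z 0 ∧ z 0 ≤ R) : ∃ z ∈ P.support, z ∈ Q.support := by
  obtain ⟨u, v, P', hu, hv, hP'sub, hP'⟩ := exists_subwalk_slab P 0 ha hb hLR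
  obtain ⟨u', v', Q', hu', hv', hQ'sub, hQ'⟩ := exists_subwalk_slab Q 1 hc hd hBT
  obtain ⟨z, hzP, hzQ⟩ := exists_mem_support_of_crossing P' Q'
    (fun z hz => ⟨(hP' z hz).1, (hP' z hz).2, hP z (hP'sub z hz)⟩)
    (fun z hz => ⟨(hQ z (hQ'sub z hz)).1, (hQ z (hQ'sub z hz)).2, hQ' z hz⟩) hu hv hu' hv'
  exact ⟨z, hP'sub z hzP, hQ'sub z hzQ⟩

/-- Any horizontal crossing of `H(x)` meets any vertical crossing of `V(x)` (in the square
`[Sx₀, Sx₀+S] × [Sx₁, Sx₁+S]`). [folklore] -/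
private theorem vacantReignition_cgs_hv (S : ℕ) (g : (Fin 2 → ℤ) → Prop) (x : Fin 2 → ℤ)
    {a b c d : Fin 2 → ℤ} (P : (zdGraph 2).Walk a b) (Q : (zdGraph 2).Walk c d)
    (ha : a 0 = (S : ℤ) * x 0 - S) (hb : b 0 = (S : ℤ) * x 0 + 2 * S)
    (hP : ∀ z ∈ P.support, ((S : ℤ) * x 0 - S ≤ z 0 ∧ z 0 ≤ (S : ℤ) * x 0 + 2 * S ∧
      (S : ℤ) * x 1 ≤ z 1 ∧ z 1 ≤ (S : ℤ) * x 1 + S) ∧ g z)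
    (hc : c 1 = (S : ℤ) * x 1 - S) (hd : d 1 = (S : ℤ) * x 1 + 2 * S)
    (hQ : ∀ z ∈ Q.support, ((S : ℤ) * x 0 ≤ z 0 ∧ z 0 ≤ (S : ℤ) * x 0 + S ∧
      (S : ℤ) * x 1 - S ≤ z 1 ∧ z 1 ≤ (S : ℤ) * x 1 + 2 * S) ∧ g z) :
    ∃ m ∈ P.support, m ∈ Q.support :=
  vacantReignition_cgs_meet P Q (L := (S : ℤ) * x 0) (R := (S : ℤ) * x 0 + S) (B := (S : ℤ) * x 1)
    (T := (S : ℤ) * x 1 + S) (by omega) (by omega) (by omega) (by omega)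
    (fun z hz => ⟨(hP z hz).1.2.2.1, (hP z hz).1.2.2.2⟩) (by omega) (by omega)
    (fun z hz => ⟨(hQ z hz).1.1, (hQ z hz).1.2.1⟩)

/-- For `S ≥ 1` only finitely many coarse sites `x` have `S x₀ - S = z₀`, `S x₁ ≤ z₁ ≤ S x₁ + S`
(the fibres of `x ↦` start of its horizontal crossing). [folklore] -/
private theorem vacantReignition_cgs_finite (S : ℕ) (hS : 1 ≤ S) (z : Fin 2 → ℤ) :
    {x : Fin 2 → ℤ | (S : ℤ) * x 0 - S = z 0 ∧ (S : ℤ) * x 1 ≤ z 1 ∧ z 1 ≤ (S : ℤ) * x 1 + S}.Finite := by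
  refine (box 2 ((z 0).natAbs + (z 1).natAbs + S)).finite_toSet.subset fun x hx => ?_
  simp only [Set.mem_setOf_eq] at hx
  obtain ⟨h0, h1, h2⟩ := hx
  rw [Finset.mem_coe, mem_box]
  have key : ∀ i, (x i).natAbs ≤ ((S : ℤ) * x i).natAbs := fun i => by
    rw [Int.natAbs_mul, Int.natAbs_natCast]; exact Nat.le_mul_of_pos_left _ hS
  have k0 := key 0
  have k1 := key 1
  refine Fin.forall_fin_two.2 ⟨?_, ?_⟩ <;> omega

/-- `ι z = (0, z₀, z₁)` maps nearest neighbours of `ℤ²` to nearest neighbours of `ℤ³`. [folklore] -/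
private theorem vacantReignition_cgs_iota_adj {u v : Fin 2 → ℤ} (h : (zdGraph 2).Adj u v) :
    (zdGraph 3).Adj (![0, u 0, u 1] : Fin 3 → ℤ) ![0, v 0, v 1] := by
  rw [zdGraph_adj_iff] at h ⊢
  obtain ⟨i, hi⟩ := h
  refine ⟨i.succ, ?_⟩
  rcases hi with rfl | rfl
  · left; funext j
    fin_cases i <;> fin_cases j <;> simp
  · right; funext j
    fin_cases i <;> fin_cases j <;> simp

/-- **Lift**: along a planar nearest-neighbour walk of blocks satisfying `G`, every block `ι z` is joined to
`ι a` in the block configuration `{E ∈ E(ℤ³) | both endpoints satisfy G}` (`openGraph_adj`). [folklore] -/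
private theorem vacantReignition_cgs_lift (G : (Fin 3 → ℤ) → Prop) {a b : Fin 2 → ℤ}
    (P : (zdGraph 2).Walk a b) (hP : ∀ z ∈ P.support, G ![0, z 0, z 1]) :
    ∀ z ∈ P.support, (openGraph {E : Sym2 (Fin 3 → ℤ) | E ∈ (zdGraph 3).edgeSet ∧ ∀ x ∈ E, G x}).Reachable
      (![0, a 0, a 1] : Fin 3 → ℤ) ![0, z 0, z 1] := by
  induction P with
  | nil =>
    intro z hz
    rw [SimpleGraph.Walk.support_nil, List.mem_singleton] at hz
    rw [hz]
  | @cons u v w huv P ih =>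
    have hu : G ![0, u 0, u 1] := hP u (SimpleGraph.Walk.start_mem_support _)
    have hP' : ∀ z ∈ P.support, G ![0, z 0, z 1] := fun z hz =>
      hP z (by rw [SimpleGraph.Walk.support_cons]; exact List.mem_cons_of_mem _ hz)
    have hv : G ![0, v 0, v 1] := hP' v (SimpleGraph.Walk.start_mem_support _)
    have h3 := vacantReignition_cgs_iota_adj huv
    have hadj : (openGraph {E : Sym2 (Fin 3 → ℤ) | E ∈ (zdGraph 3).edgeSet ∧ ∀ x ∈ E, G x}).Adj
        (![0, u 0, u 1] : Fin 3 → ℤ) ![0, v 0, v 1] := by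
      rw [openGraph_adj]
      refine ⟨⟨(SimpleGraph.mem_edgeSet _).2 h3, fun x hx => ?_⟩, h3.ne⟩
      rcases Sym2.mem_iff.1 hx with rfl | rfl
      · exact hu
      · exact hv
    intro z hz
    rw [SimpleGraph.Walk.support_cons, List.mem_cons] at hz
    rcases hz with rfl | hz
    · exact SimpleGraph.Reachable.refl _
    · exact hadj.reachable.trans (ih hP' z hz)

/-- **All or nothing at a site** with a vertical crossing: if `T` is closed under planar `g`-walks and some
`g`-good horizontal crossing of `H(x)` touches `T`, then every `g`-good horizontal crossing of `H(x)` and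
every `g`-good vertical crossing of `V(x)` lies in `T` (`vacantReignition_cgs_hv`). [folklore] -/
private theorem vacantReignition_cgs_site (S : ℕ) (g : (Fin 2 → ℤ) → Prop) (T : Set (Fin 2 → ℤ))
    (hT : ∀ (a b : Fin 2 → ℤ) (P : (zdGraph 2).Walk a b), (∀ z ∈ P.support, g z) →
      (∃ z ∈ P.support, z ∈ T) → ∀ z ∈ P.support, z ∈ T) (x : Fin 2 → ℤ)
    (hV : ∃ a b : Fin 2 → ℤ, a 1 = (S : ℤ) * x 1 - S ∧ b 1 = (S : ℤ) * x 1 + 2 * S ∧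
      ∃ P : (zdGraph 2).Walk a b, ∀ z ∈ P.support, ((S : ℤ) * x 0 ≤ z 0 ∧ z 0 ≤ (S : ℤ) * x 0 + S ∧
        (S : ℤ) * x 1 - S ≤ z 1 ∧ z 1 ≤ (S : ℤ) * x 1 + 2 * S) ∧ g z)
    (htouch : ∃ a b : Fin 2 → ℤ, a 0 = (S : ℤ) * x 0 - S ∧ b 0 = (S : ℤ) * x 0 + 2 * S ∧
      ∃ P : (zdGraph 2).Walk a b, (∀ z ∈ P.support, ((S : ℤ) * x 0 - S ≤ z 0 ∧ z 0 ≤ (S : ℤ) * x 0 + 2 * S ∧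
        (S : ℤ) * x 1 ≤ z 1 ∧ z 1 ≤ (S : ℤ) * x 1 + S) ∧ g z) ∧ ∃ z ∈ P.support, z ∈ T) :
    (∀ (a b : Fin 2 → ℤ) (P : (zdGraph 2).Walk a b), a 0 = (S : ℤ) * x 0 - S → b 0 = (S : ℤ) * x 0 + 2 * S →
      (∀ z ∈ P.support, ((S : ℤ) * x 0 - S ≤ z 0 ∧ z 0 ≤ (S : ℤ) * x 0 + 2 * S ∧ (S : ℤ) * x 1 ≤ z 1 ∧
        z 1 ≤ (S : ℤ) * x 1 + S) ∧ g z) → ∀ z ∈ P.support, z ∈ T) ∧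
    (∀ (a b : Fin 2 → ℤ) (P : (zdGraph 2).Walk a b), a 1 = (S : ℤ) * x 1 - S → b 1 = (S : ℤ) * x 1 + 2 * S →
      (∀ z ∈ P.support, ((S : ℤ) * x 0 ≤ z 0 ∧ z 0 ≤ (S : ℤ) * x 0 + S ∧ (S : ℤ) * x 1 - S ≤ z 1 ∧
        z 1 ≤ (S : ℤ) * x 1 + 2 * S) ∧ g z) → ∀ z ∈ P.support, z ∈ T) := by
  obtain ⟨a, b, ha, hb, P, hP, hz₁⟩ := htouch
  have hPT : ∀ z ∈ P.support, z ∈ T := hT a b P (fun z hz => (hP z hz).2) hz₁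
  have hVall : ∀ (c d : Fin 2 → ℤ) (Q : (zdGraph 2).Walk c d), c 1 = (S : ℤ) * x 1 - S →
      d 1 = (S : ℤ) * x 1 + 2 * S → (∀ z ∈ Q.support, ((S : ℤ) * x 0 ≤ z 0 ∧ z 0 ≤ (S : ℤ) * x 0 + S ∧
        (S : ℤ) * x 1 - S ≤ z 1 ∧ z 1 ≤ (S : ℤ) * x 1 + 2 * S) ∧ g z) → ∀ z ∈ Q.support, z ∈ T := by
    intro c d Q hc hd hQ
    obtain ⟨m, hmP, hmQ⟩ := vacantReignition_cgs_hv S g x P Q ha hb hP hc hd hQ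
    exact hT c d Q (fun z hz => (hQ z hz).2) ⟨m, hmQ, hPT m hmP⟩
  refine ⟨fun a' b' P' ha' hb' hP' => ?_, hVall⟩
  obtain ⟨c, d, hc, hd, Q, hQ⟩ := hV
  obtain ⟨m, hmP, hmQ⟩ := vacantReignition_cgs_hv S g x P' Q ha' hb' hP' hc hd hQ
  exact hT a' b' P' (fun z hz => (hP' z hz).2) ⟨m, hmP, hVall c d Q hc hd hQ m hmQ⟩

/-- **Crossings of `★`-adjacent open sites meet** (ADKS p. 6).  If all good crossings of the open site `x`
lie in `T` and `x'` is an open `★`-neighbour, some good horizontal crossing of `H(x')` touches `T`: for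
`x' = x + e₁ (± e₂)` `H(x)` meets `V(x')` in `[Sx₀+S, Sx₀+2S] × [Sx₁, Sx₁+S]`, for `x' = x + e₂` `V(x)`
meets `H(x')` in `[Sx₀, Sx₀+S] × [Sx₁+S, Sx₁+2S]`, mirror cases likewise; a touched vertical crossing of
`x'` is traded for a horizontal one through `vacantReignition_cgs_hv`.
[cite: AhlbergEtAl2015, §2 (proof of Thm 1, p. 6)] -/
private theorem vacantReignition_cgs_step (S : ℕ) (g : (Fin 2 → ℤ) → Prop) (T : Set (Fin 2 → ℤ))
    (hT : ∀ (a b : Fin 2 → ℤ) (P : (zdGraph 2).Walk a b), (∀ z ∈ P.support, g z) →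
      (∃ z ∈ P.support, z ∈ T) → ∀ z ∈ P.support, z ∈ T) {x x' : Fin 2 → ℤ} (hadj : (zdStar 2).Adj x x')
    (hx : (∃ a b : Fin 2 → ℤ, a 0 = (S : ℤ) * x 0 - S ∧ b 0 = (S : ℤ) * x 0 + 2 * S ∧
      ∃ P : (zdGraph 2).Walk a b, ∀ z ∈ P.support, ((S : ℤ) * x 0 - S ≤ z 0 ∧ z 0 ≤ (S : ℤ) * x 0 + 2 * S ∧
        (S : ℤ) * x 1 ≤ z 1 ∧ z 1 ≤ (S : ℤ) * x 1 + S) ∧ g z) ∧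
      (∃ a b : Fin 2 → ℤ, a 1 = (S : ℤ) * x 1 - S ∧ b 1 = (S : ℤ) * x 1 + 2 * S ∧
      ∃ P : (zdGraph 2).Walk a b, ∀ z ∈ P.support, ((S : ℤ) * x 0 ≤ z 0 ∧ z 0 ≤ (S : ℤ) * x 0 + S ∧
        (S : ℤ) * x 1 - S ≤ z 1 ∧ z 1 ≤ (S : ℤ) * x 1 + 2 * S) ∧ g z))
    (hx' : (∃ a b : Fin 2 → ℤ, a 0 = (S : ℤ) * x' 0 - S ∧ b 0 = (S : ℤ) * x' 0 + 2 * S ∧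
      ∃ P : (zdGraph 2).Walk a b, ∀ z ∈ P.support, ((S : ℤ) * x' 0 - S ≤ z 0 ∧ z 0 ≤ (S : ℤ) * x' 0 + 2 * S ∧
        (S : ℤ) * x' 1 ≤ z 1 ∧ z 1 ≤ (S : ℤ) * x' 1 + S) ∧ g z) ∧
      (∃ a b : Fin 2 → ℤ, a 1 = (S : ℤ) * x' 1 - S ∧ b 1 = (S : ℤ) * x' 1 + 2 * S ∧
      ∃ P : (zdGraph 2).Walk a b, ∀ z ∈ P.support, ((S : ℤ) * x' 0 ≤ z 0 ∧ z 0 ≤ (S : ℤ) * x' 0 + S ∧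
        (S : ℤ) * x' 1 - S ≤ z 1 ∧ z 1 ≤ (S : ℤ) * x' 1 + 2 * S) ∧ g z))
    (hin : (∀ (a b : Fin 2 → ℤ) (P : (zdGraph 2).Walk a b), a 0 = (S : ℤ) * x 0 - S → b 0 = (S : ℤ) * x 0 + 2 * S →
      (∀ z ∈ P.support, ((S : ℤ) * x 0 - S ≤ z 0 ∧ z 0 ≤ (S : ℤ) * x 0 + 2 * S ∧ (S : ℤ) * x 1 ≤ z 1 ∧
        z 1 ≤ (S : ℤ) * x 1 + S) ∧ g z) → ∀ z ∈ P.support, z ∈ T) ∧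
    (∀ (a b : Fin 2 → ℤ) (P : (zdGraph 2).Walk a b), a 1 = (S : ℤ) * x 1 - S → b 1 = (S : ℤ) * x 1 + 2 * S →
      (∀ z ∈ P.support, ((S : ℤ) * x 0 ≤ z 0 ∧ z 0 ≤ (S : ℤ) * x 0 + S ∧ (S : ℤ) * x 1 - S ≤ z 1 ∧
        z 1 ≤ (S : ℤ) * x 1 + 2 * S) ∧ g z) → ∀ z ∈ P.support, z ∈ T)) :
    ∃ a b : Fin 2 → ℤ, a 0 = (S : ℤ) * x' 0 - S ∧ b 0 = (S : ℤ) * x' 0 + 2 * S ∧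
      ∃ P : (zdGraph 2).Walk a b, (∀ z ∈ P.support, ((S : ℤ) * x' 0 - S ≤ z 0 ∧ z 0 ≤ (S : ℤ) * x' 0 + 2 * S ∧
        (S : ℤ) * x' 1 ≤ z 1 ∧ z 1 ≤ (S : ℤ) * x' 1 + S) ∧ g z) ∧ ∃ z ∈ P.support, z ∈ T := by
  have h0 := natAbs_sub_le_one_of_adj hadj 0
  have h1 := natAbs_sub_le_one_of_adj hadj 1
  have hS0 : (0 : ℤ) ≤ S := Nat.cast_nonneg S
  have hb1 : (S : ℤ) * x 1 - S ≤ S * x' 1 := by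
    have := mul_le_mul_of_nonneg_left (show x 1 - 1 ≤ x' 1 by omega) hS0; linarith
  have hb1' : (S : ℤ) * x' 1 ≤ S * x 1 + S := by
    have := mul_le_mul_of_nonneg_left (show x' 1 ≤ x 1 + 1 by omega) hS0; linarith
  -- a touched vertical crossing `Q` of `x'` yields a touched horizontal one
  have trade : ∀ (c d : Fin 2 → ℤ) (Q : (zdGraph 2).Walk c d), c 1 = (S : ℤ) * x' 1 - S →
      d 1 = (S : ℤ) * x' 1 + 2 * S → (∀ z ∈ Q.support, ((S : ℤ) * x' 0 ≤ z 0 ∧ z 0 ≤ (S : ℤ) * x' 0 + S ∧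
        (S : ℤ) * x' 1 - S ≤ z 1 ∧ z 1 ≤ (S : ℤ) * x' 1 + 2 * S) ∧ g z) → (∃ z ∈ Q.support, z ∈ T) →
      ∃ a b : Fin 2 → ℤ, a 0 = (S : ℤ) * x' 0 - S ∧ b 0 = (S : ℤ) * x' 0 + 2 * S ∧
        ∃ P : (zdGraph 2).Walk a b, (∀ z ∈ P.support, ((S : ℤ) * x' 0 - S ≤ z 0 ∧
          z 0 ≤ (S : ℤ) * x' 0 + 2 * S ∧ (S : ℤ) * x' 1 ≤ z 1 ∧ z 1 ≤ (S : ℤ) * x' 1 + S) ∧ g z) ∧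
          ∃ z ∈ P.support, z ∈ T := by
    intro c d Q hc hd hQ hQt
    have hQT : ∀ z ∈ Q.support, z ∈ T := hT c d Q (fun z hz => (hQ z hz).2) hQt
    obtain ⟨a, b, ha, hb, P, hP⟩ := hx'.1
    obtain ⟨m, hmP, hmQ⟩ := vacantReignition_cgs_hv S g x' P Q ha hb hP hc hd hQ
    exact ⟨a, b, ha, hb, P, hP, m, hmP, hQT m hmQ⟩
  rcases (by omega : x' 0 = x 0 + 1 ∨ x' 0 = x 0 - 1 ∨ x' 0 = x 0) with he | he | he
  · -- `x' = x + e₁ (± e₂)`: `H(x)` meets `V(x')` in `[Sx₀+S, Sx₀+2S] × [Sx₁, Sx₁+S]`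
    have hSe : (S : ℤ) * x' 0 = S * x 0 + S := by rw [he]; ring
    obtain ⟨a, b, ha, hb, P, hP⟩ := hx.1
    obtain ⟨c, d, hc, hd, Q, hQ⟩ := hx'.2
    obtain ⟨m, hmP, hmQ⟩ := vacantReignition_cgs_meet P Q (L := (S : ℤ) * x 0 + S) (R := (S : ℤ) * x 0 + 2 * S)
      (B := (S : ℤ) * x 1) (T := (S : ℤ) * x 1 + S) (by omega) (by omega) (by omega) (by omega)
      (fun z hz => ⟨(hP z hz).1.2.2.1, (hP z hz).1.2.2.2⟩) (by omega) (by omega)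
      (fun z hz => ⟨by have := (hQ z hz).1.1; omega, by have := (hQ z hz).1.2.1; omega⟩)
    exact trade c d Q hc hd hQ ⟨m, hmQ, hin.1 a b P ha hb hP m hmP⟩
  · -- `x' = x - e₁ (± e₂)`: `H(x')` meets `V(x)` in `[Sx₀, Sx₀+S] × [Sx'₁, Sx'₁+S]`
    have hSe : (S : ℤ) * x' 0 = S * x 0 - S := by rw [he]; ring
    obtain ⟨a, b, ha, hb, P, hP⟩ := hx'.1
    obtain ⟨c, d, hc, hd, Q, hQ⟩ := hx.2
    obtain ⟨m, hmP, hmQ⟩ := vacantReignition_cgs_meet P Q (L := (S : ℤ) * x 0) (R := (S : ℤ) * x 0 + S)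
      (B := (S : ℤ) * x' 1) (T := (S : ℤ) * x' 1 + S) (by omega) (by omega) (by omega) (by omega)
      (fun z hz => ⟨(hP z hz).1.2.2.1, (hP z hz).1.2.2.2⟩) (by omega) (by omega)
      (fun z hz => ⟨(hQ z hz).1.1, (hQ z hz).1.2.1⟩)
    exact ⟨a, b, ha, hb, P, hP, m, hmP, hin.2 c d Q hc hd hQ m hmQ⟩
  · have hSe : (S : ℤ) * x' 0 = S * x 0 := by rw [he]
    rcases (by omega : x' 1 = x 1 + 1 ∨ x' 1 = x 1 - 1 ∨ x' 1 = x 1) with he' | he' | he'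
    · -- `x' = x + e₂`: `H(x')` meets `V(x)` in `[Sx₀, Sx₀+S] × [Sx₁+S, Sx₁+2S]`
      have hSe' : (S : ℤ) * x' 1 = S * x 1 + S := by rw [he']; ring
      obtain ⟨a, b, ha, hb, P, hP⟩ := hx'.1
      obtain ⟨c, d, hc, hd, Q, hQ⟩ := hx.2
      obtain ⟨m, hmP, hmQ⟩ := vacantReignition_cgs_meet P Q (L := (S : ℤ) * x 0) (R := (S : ℤ) * x 0 + S)
        (B := (S : ℤ) * x 1 + S) (T := (S : ℤ) * x 1 + 2 * S) (by omega) (by omega) (by omega) (by omega)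
        (fun z hz => ⟨by have := (hP z hz).1.2.2.1; omega, by have := (hP z hz).1.2.2.2; omega⟩)
        (by omega) (by omega) (fun z hz => ⟨(hQ z hz).1.1, (hQ z hz).1.2.1⟩)
      exact ⟨a, b, ha, hb, P, hP, m, hmP, hin.2 c d Q hc hd hQ m hmQ⟩
    · -- `x' = x - e₂`: `H(x)` meets `V(x')` in `[Sx₀, Sx₀+S] × [Sx₁, Sx₁+S]`
      have hSe' : (S : ℤ) * x' 1 = S * x 1 - S := by rw [he']; ring
      obtain ⟨a, b, ha, hb, P, hP⟩ := hx.1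
      obtain ⟨c, d, hc, hd, Q, hQ⟩ := hx'.2
      obtain ⟨m, hmP, hmQ⟩ := vacantReignition_cgs_meet P Q (L := (S : ℤ) * x 0) (R := (S : ℤ) * x 0 + S)
        (B := (S : ℤ) * x 1) (T := (S : ℤ) * x 1 + S) (by omega) (by omega) (by omega) (by omega)
        (fun z hz => ⟨(hP z hz).1.2.2.1, (hP z hz).1.2.2.2⟩) (by omega) (by omega)
        (fun z hz => ⟨by have := (hQ z hz).1.1; omega, by have := (hQ z hz).1.2.1; omega⟩)
      exact trade c d Q hc hd hQ ⟨m, hmQ, hin.1 a b P ha hb hP m hmP⟩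
    · exact (hadj.ne (Site.eq_iff_two.2 ⟨he.symm, he'.symm⟩)).elim

/-- **Coarse gluing, abstract form.**  For a block predicate `G` on `ℤ³` and a set `O` of coarse sites each
having a horizontal crossing of `H(x)` and a vertical crossing of `V(x)` by planar walks of blocks `z` with
`G (ι z)`: if `x₀ ∈ O` and the `★`-cluster of `O` at `x₀` is infinite, then some block `z ∈ H(x₀)` (the start
of a horizontal crossing of `x₀`) has an infinite cluster at `ι z` in `{E ∈ E(ℤ³) | both endpoints satisfy G}`
(chaining `_site`/`_step` along the cluster, finite fibres `_finite`, injectivity of `ι`).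
[cite: AhlbergEtAl2015, §2 (proof of Thm 1, p. 6)] -/
theorem vacantReignition_cgs_core : ∀ (S : ℕ), 1 ≤ S → ∀ (G : (Fin 3 → ℤ) → Prop)
    {O : Set (Fin 2 → ℤ)} {x₀ : Fin 2 → ℤ},
    {x : Fin 2 → ℤ | Relation.ReflTransGen (starRel O) x₀ x}.Infinite → x₀ ∈ O →
    (∀ x ∈ O,
      (∃ a b : Fin 2 → ℤ, a 0 = (S : ℤ) * x 0 - S ∧ b 0 = (S : ℤ) * x 0 + 2 * S ∧
        ∃ P : (zdGraph 2).Walk a b, ∀ z ∈ P.support, ((S : ℤ) * x 0 - S ≤ z 0 ∧ z 0 ≤ (S : ℤ) * x 0 + 2 * S ∧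
          (S : ℤ) * x 1 ≤ z 1 ∧ z 1 ≤ (S : ℤ) * x 1 + S) ∧ G ![0, z 0, z 1]) ∧
      (∃ a b : Fin 2 → ℤ, a 1 = (S : ℤ) * x 1 - S ∧ b 1 = (S : ℤ) * x 1 + 2 * S ∧
        ∃ P : (zdGraph 2).Walk a b, ∀ z ∈ P.support, ((S : ℤ) * x 0 ≤ z 0 ∧ z 0 ≤ (S : ℤ) * x 0 + S ∧
          (S : ℤ) * x 1 - S ≤ z 1 ∧ z 1 ≤ (S : ℤ) * x 1 + 2 * S) ∧ G ![0, z 0, z 1])) →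
    ∃ z : Fin 2 → ℤ, ((S : ℤ) * x₀ 0 - S ≤ z 0 ∧ z 0 ≤ (S : ℤ) * x₀ 0 + 2 * S ∧
        (S : ℤ) * x₀ 1 ≤ z 1 ∧ z 1 ≤ (S : ℤ) * x₀ 1 + S) ∧
      (openCluster {E : Sym2 (Fin 3 → ℤ) | E ∈ (zdGraph 3).edgeSet ∧ ∀ x ∈ E, G x}
        (![0, z 0, z 1] : Fin 3 → ℤ)).Infinite := by
  intro S hS G O x₀ hinf hx₀ hO
  obtain ⟨⟨a₀, b₀, ha₀, hb₀, P₀, hP₀⟩, -⟩ := hO x₀ hx₀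
  refine ⟨a₀, (hP₀ a₀ P₀.start_mem_support).1, ?_⟩
  set ω : Set (Sym2 (Fin 3 → ℤ)) := {E : Sym2 (Fin 3 → ℤ) | E ∈ (zdGraph 3).edgeSet ∧ ∀ x ∈ E, G x}
  -- the planar trace of the block cluster of `ι a₀`; it is closed under planar walks of good sites
  set T : Set (Fin 2 → ℤ) := (fun z : Fin 2 → ℤ => (![0, z 0, z 1] : Fin 3 → ℤ)) ⁻¹'
    openCluster ω (![0, a₀ 0, a₀ 1] : Fin 3 → ℤ)
  have hTcl : ∀ (a b : Fin 2 → ℤ) (P : (zdGraph 2).Walk a b), (∀ z ∈ P.support, G ![0, z 0, z 1]) →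
      (∃ z ∈ P.support, z ∈ T) → ∀ z ∈ P.support, z ∈ T := by
    rintro a b P hP ⟨z₁, hz₁, hz₁T⟩ z hz
    have h0 : (openGraph ω).Reachable (![0, a₀ 0, a₀ 1] : Fin 3 → ℤ) ![0, z₁ 0, z₁ 1] := hz₁T
    change (openGraph ω).Reachable (![0, a₀ 0, a₀ 1] : Fin 3 → ℤ) ![0, z 0, z 1]
    exact (h0.trans (vacantReignition_cgs_lift G P hP z₁ hz₁).symm).trans
      (vacantReignition_cgs_lift G P hP z hz)
  -- chaining along the `★`-cluster: every crossing of every site of the cluster lies in `T`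
  have key : ∀ x, Relation.ReflTransGen (starRel O) x₀ x →
      (∀ (a b : Fin 2 → ℤ) (P : (zdGraph 2).Walk a b), a 0 = (S : ℤ) * x 0 - S → b 0 = (S : ℤ) * x 0 + 2 * S →
        (∀ z ∈ P.support, ((S : ℤ) * x 0 - S ≤ z 0 ∧ z 0 ≤ (S : ℤ) * x 0 + 2 * S ∧ (S : ℤ) * x 1 ≤ z 1 ∧
          z 1 ≤ (S : ℤ) * x 1 + S) ∧ G ![0, z 0, z 1]) → ∀ z ∈ P.support, z ∈ T) ∧
      (∀ (a b : Fin 2 → ℤ) (P : (zdGraph 2).Walk a b), a 1 = (S : ℤ) * x 1 - S → b 1 = (S : ℤ) * x 1 + 2 * S →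
        (∀ z ∈ P.support, ((S : ℤ) * x 0 ≤ z 0 ∧ z 0 ≤ (S : ℤ) * x 0 + S ∧ (S : ℤ) * x 1 - S ≤ z 1 ∧
          z 1 ≤ (S : ℤ) * x 1 + 2 * S) ∧ G ![0, z 0, z 1]) → ∀ z ∈ P.support, z ∈ T) := by
    intro x hx
    induction hx with
    | refl =>
      exact vacantReignition_cgs_site S (fun z => G ![0, z 0, z 1]) T hTcl x₀ (hO x₀ hx₀).2
        ⟨a₀, b₀, ha₀, hb₀, P₀, hP₀, a₀, P₀.start_mem_support,
          (SimpleGraph.Reachable.refl _ : (openGraph ω).Reachable (![0, a₀ 0, a₀ 1] : Fin 3 → ℤ)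
            ![0, a₀ 0, a₀ 1])⟩
    | tail _ hbc ih =>
      exact vacantReignition_cgs_site S (fun z => G ![0, z 0, z 1]) T hTcl _ (hO _ hbc.2.2).2
        (vacantReignition_cgs_step S (fun z => G ![0, z 0, z 1]) T hTcl hbc.1 (hO _ hbc.2.1)
          (hO _ hbc.2.2) ih)
  -- `T` is infinite: the start `a(x) ∈ T` of a horizontal crossing of a cluster site `x` has finite fibres
  have hTinf : T.Infinite := by
    intro hTfin
    refine hinf ((hTfin.biUnion fun z _ => vacantReignition_cgs_finite S hS z).subset fun x hx => ?_)
    rw [Set.mem_iUnion₂]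
    obtain ⟨⟨a, b, ha, hb, P, hP⟩, -⟩ := hO x (mem_of_reflTransGen_starRel hx hx₀)
    exact ⟨a, (key x hx).1 a b P ha hb hP a P.start_mem_support, ha.symm,
      (hP a P.start_mem_support).1.2.2⟩
  -- `ι` is injective, so the block cluster is infinite too
  exact fun hfin => hTinf (hfin.preimage fun z _ z' _ h =>
    Site.eq_iff_two.2 ⟨(congrFun h 1 : z 0 = z' 0), (congrFun h 2 : z 1 = z' 1)⟩)

/-- **COARSE GLUING** (registered stub `stub_coarseGlue` of line `holes-are-fresh`; ADKS p. 6 step 2,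
deterministic).  Spacing `S ≥ 1`, block scale `L`, aspect `k`, levels `p, q`, label pair `π`; a block
`x ∈ ℤ³` is VG if its window `(2L+1)x + B(blockR L k)` misses the infinite `ω_p(π.1)`-clusters and the
fresh configuration `ω_q(π.2)` seen from `(2L+1)x` is (8.90)-good; a coarse site `x'` is OPEN if `H(x')` has
a left-right and `V(x')` a bottom-top crossing by planar nearest-neighbour walks of blocks `z` with
`(0, z₀, z₁)` VG.  If `0` is open and the `★`-cluster of open sites at `0` is infinite, some `z ∈ H(0)` has an
infinite cluster at `(0, z₀, z₁)` in the block configuration `{E ∈ E(ℤ³) | both endpoints VG}`: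
`vacantReignition_cgs_core` with `G = VG`, `O = {open sites}`, `x₀ = 0`.
[cite: AhlbergEtAl2015, §2 (proof of Thm 1, p. 6)] -/
theorem stub_coarseGlue :
    ∀ k S L : ℕ, 1 ≤ S → ∀ (p q : ℝ) (π : (Sym2 (Fin 3 → ℤ) → ℝ) × (Sym2 (Fin 3 → ℤ) → ℝ)),
      ((∃ a b : Fin 2 → ℤ, a 0 = (S : ℤ) * (0 : Fin 2 → ℤ) 0 - S ∧ b 0 = (S : ℤ) * (0 : Fin 2 → ℤ) 0 + 2 * S ∧
        ∃ P : (zdGraph 2).Walk a b, ∀ z ∈ P.support, ((S : ℤ) * (0 : Fin 2 → ℤ) 0 - S ≤ z 0 ∧ z 0 ≤ (S : ℤ) * (0 : Fin 2 → ℤ) 0 + 2 * S ∧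
          (S : ℤ) * (0 : Fin 2 → ℤ) 1 ≤ z 1 ∧ z 1 ≤ (S : ℤ) * (0 : Fin 2 → ℤ) 1 + S) ∧
        (∀ y ∈ (↑(box 3 (blockR L k)) : Set (Fin 3 → ℤ)),
          ¬ (openCluster (configOfLabels p π.1 (zdGraph 3)) (((2 * L + 1 : ℕ) : ℤ) • (![0, z 0, z 1] : Fin 3 → ℤ) + y)).Infinite) ∧
        ((∃ w ∈ (↑(box 3 L) : Set (Fin 3 → ℤ)),
          BondConfig.relabel (sym2Equiv (Site.shift (-(((2 * L + 1 : ℕ) : ℤ) • (![0, z 0, z 1] : Fin 3 → ℤ))))) (configOfLabels q π.2 (zdGraph 3)) ∈ boxArm (blockR L k + (2 * L + 1)) w) ∧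
        ∀ u ∈ (↑(box 3 (3 * L + 1)) : Set (Fin 3 → ℤ)), ∀ v ∈ (↑(box 3 (3 * L + 1)) : Set (Fin 3 → ℤ)),
          BondConfig.relabel (sym2Equiv (Site.shift (-(((2 * L + 1 : ℕ) : ℤ) • (![0, z 0, z 1] : Fin 3 → ℤ))))) (configOfLabels q π.2 (zdGraph 3)) ∉ twoArm (blockR L k) u v)) ∧
        (∃ a b : Fin 2 → ℤ, a 1 = (S : ℤ) * (0 : Fin 2 → ℤ) 1 - S ∧ b 1 = (S : ℤ) * (0 : Fin 2 → ℤ) 1 + 2 * S ∧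
        ∃ P : (zdGraph 2).Walk a b, ∀ z ∈ P.support, ((S : ℤ) * (0 : Fin 2 → ℤ) 0 ≤ z 0 ∧ z 0 ≤ (S : ℤ) * (0 : Fin 2 → ℤ) 0 + S ∧
          (S : ℤ) * (0 : Fin 2 → ℤ) 1 - S ≤ z 1 ∧ z 1 ≤ (S : ℤ) * (0 : Fin 2 → ℤ) 1 + 2 * S) ∧
        (∀ y ∈ (↑(box 3 (blockR L k)) : Set (Fin 3 → ℤ)),
          ¬ (openCluster (configOfLabels p π.1 (zdGraph 3)) (((2 * L + 1 : ℕ) : ℤ) • (![0, z 0, z 1] : Fin 3 → ℤ) + y)).Infinite) ∧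
        ((∃ w ∈ (↑(box 3 L) : Set (Fin 3 → ℤ)),
          BondConfig.relabel (sym2Equiv (Site.shift (-(((2 * L + 1 : ℕ) : ℤ) • (![0, z 0, z 1] : Fin 3 → ℤ))))) (configOfLabels q π.2 (zdGraph 3)) ∈ boxArm (blockR L k + (2 * L + 1)) w) ∧
        ∀ u ∈ (↑(box 3 (3 * L + 1)) : Set (Fin 3 → ℤ)), ∀ v ∈ (↑(box 3 (3 * L + 1)) : Set (Fin 3 → ℤ)),
          BondConfig.relabel (sym2Equiv (Site.shift (-(((2 * L + 1 : ℕ) : ℤ) • (![0, z 0, z 1] : Fin 3 → ℤ))))) (configOfLabels q π.2 (zdGraph 3)) ∉ twoArm (blockR L k) u v))) →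
      {x : Fin 2 → ℤ | Relation.ReflTransGen (starRel {x' : Fin 2 → ℤ |
        ((∃ a b : Fin 2 → ℤ, a 0 = (S : ℤ) * x' 0 - S ∧ b 0 = (S : ℤ) * x' 0 + 2 * S ∧
        ∃ P : (zdGraph 2).Walk a b, ∀ z ∈ P.support, ((S : ℤ) * x' 0 - S ≤ z 0 ∧ z 0 ≤ (S : ℤ) * x' 0 + 2 * S ∧
          (S : ℤ) * x' 1 ≤ z 1 ∧ z 1 ≤ (S : ℤ) * x' 1 + S) ∧
        (∀ y ∈ (↑(box 3 (blockR L k)) : Set (Fin 3 → ℤ)),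
          ¬ (openCluster (configOfLabels p π.1 (zdGraph 3)) (((2 * L + 1 : ℕ) : ℤ) • (![0, z 0, z 1] : Fin 3 → ℤ) + y)).Infinite) ∧
        ((∃ w ∈ (↑(box 3 L) : Set (Fin 3 → ℤ)),
          BondConfig.relabel (sym2Equiv (Site.shift (-(((2 * L + 1 : ℕ) : ℤ) • (![0, z 0, z 1] : Fin 3 → ℤ))))) (configOfLabels q π.2 (zdGraph 3)) ∈ boxArm (blockR L k + (2 * L + 1)) w) ∧
        ∀ u ∈ (↑(box 3 (3 * L + 1)) : Set (Fin 3 → ℤ)), ∀ v ∈ (↑(box 3 (3 * L + 1)) : Set (Fin 3 → ℤ)),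
          BondConfig.relabel (sym2Equiv (Site.shift (-(((2 * L + 1 : ℕ) : ℤ) • (![0, z 0, z 1] : Fin 3 → ℤ))))) (configOfLabels q π.2 (zdGraph 3)) ∉ twoArm (blockR L k) u v)) ∧
        (∃ a b : Fin 2 → ℤ, a 1 = (S : ℤ) * x' 1 - S ∧ b 1 = (S : ℤ) * x' 1 + 2 * S ∧
        ∃ P : (zdGraph 2).Walk a b, ∀ z ∈ P.support, ((S : ℤ) * x' 0 ≤ z 0 ∧ z 0 ≤ (S : ℤ) * x' 0 + S ∧
          (S : ℤ) * x' 1 - S ≤ z 1 ∧ z 1 ≤ (S : ℤ) * x' 1 + 2 * S) ∧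
        (∀ y ∈ (↑(box 3 (blockR L k)) : Set (Fin 3 → ℤ)),
          ¬ (openCluster (configOfLabels p π.1 (zdGraph 3)) (((2 * L + 1 : ℕ) : ℤ) • (![0, z 0, z 1] : Fin 3 → ℤ) + y)).Infinite) ∧
        ((∃ w ∈ (↑(box 3 L) : Set (Fin 3 → ℤ)),
          BondConfig.relabel (sym2Equiv (Site.shift (-(((2 * L + 1 : ℕ) : ℤ) • (![0, z 0, z 1] : Fin 3 → ℤ))))) (configOfLabels q π.2 (zdGraph 3)) ∈ boxArm (blockR L k + (2 * L + 1)) w) ∧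
        ∀ u ∈ (↑(box 3 (3 * L + 1)) : Set (Fin 3 → ℤ)), ∀ v ∈ (↑(box 3 (3 * L + 1)) : Set (Fin 3 → ℤ)),
          BondConfig.relabel (sym2Equiv (Site.shift (-(((2 * L + 1 : ℕ) : ℤ) • (![0, z 0, z 1] : Fin 3 → ℤ))))) (configOfLabels q π.2 (zdGraph 3)) ∉ twoArm (blockR L k) u v)))}) 0 x}.Infinite →
      ∃ z : Fin 2 → ℤ, ((S : ℤ) * (0 : Fin 2 → ℤ) 0 - S ≤ z 0 ∧ z 0 ≤ (S : ℤ) * (0 : Fin 2 → ℤ) 0 + 2 * S ∧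
          (S : ℤ) * (0 : Fin 2 → ℤ) 1 ≤ z 1 ∧ z 1 ≤ (S : ℤ) * (0 : Fin 2 → ℤ) 1 + S) ∧
        (openCluster {E : Sym2 (Fin 3 → ℤ) | E ∈ (zdGraph 3).edgeSet ∧ ∀ x ∈ E,
        (∀ y ∈ (↑(box 3 (blockR L k)) : Set (Fin 3 → ℤ)),
          ¬ (openCluster (configOfLabels p π.1 (zdGraph 3)) (((2 * L + 1 : ℕ) : ℤ) • x + y)).Infinite) ∧
        ((∃ w ∈ (↑(box 3 L) : Set (Fin 3 → ℤ)),
          BondConfig.relabel (sym2Equiv (Site.shift (-(((2 * L + 1 : ℕ) : ℤ) • x)))) (configOfLabels q π.2 (zdGraph 3)) ∈ boxArm (blockR L k + (2 * L + 1)) w) ∧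
        ∀ u ∈ (↑(box 3 (3 * L + 1)) : Set (Fin 3 → ℤ)), ∀ v ∈ (↑(box 3 (3 * L + 1)) : Set (Fin 3 → ℤ)),
          BondConfig.relabel (sym2Equiv (Site.shift (-(((2 * L + 1 : ℕ) : ℤ) • x)))) (configOfLabels q π.2 (zdGraph 3)) ∉ twoArm (blockR L k) u v)}
        (![0, z 0, z 1] : Fin 3 → ℤ)).Infinite := by
  intro k S L hS p q π hopen hinf
  exact vacantReignition_cgs_core S hS
    (fun x : Fin 3 → ℤ =>
      (∀ y ∈ (↑(box 3 (blockR L k)) : Set (Fin 3 → ℤ)),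
          ¬ (openCluster (configOfLabels p π.1 (zdGraph 3)) (((2 * L + 1 : ℕ) : ℤ) • x + y)).Infinite) ∧
        ((∃ w ∈ (↑(box 3 L) : Set (Fin 3 → ℤ)),
          BondConfig.relabel (sym2Equiv (Site.shift (-(((2 * L + 1 : ℕ) : ℤ) • x))))
            (configOfLabels q π.2 (zdGraph 3)) ∈ boxArm (blockR L k + (2 * L + 1)) w) ∧
        ∀ u ∈ (↑(box 3 (3 * L + 1)) : Set (Fin 3 → ℤ)), ∀ v ∈ (↑(box 3 (3 * L + 1)) : Set (Fin 3 → ℤ)),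
          BondConfig.relabel (sym2Equiv (Site.shift (-(((2 * L + 1 : ℕ) : ℤ) • x))))
            (configOfLabels q π.2 (zdGraph 3)) ∉ twoArm (blockR L k) u v))
    hinf hopen (fun x hx => hx)

end Summit.CriticalPhenomena.PercolationContinuityZ3.Theorems

end
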